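import Summits.QuantumFields.YangMills.Theorems.BalabanUVNodesN12EUStepTokensAtFlatDatum
import Summits.QuantumFields.YangMills.Theorems.BalabanUVNodesN12FlatDatumRigidityNestedLam
import Literature.MathematicalPhysics.QuantumFieldTheory.Balaban1983to89.B11Thm1ExistsUniqueTruncationData
import Literature.MathematicalPhysics.QuantumFieldTheory.Balaban1983to89.B11Thm1ExistsUniqueTokensGBBridges
import HarnessLib

/-!
# DAG node N12 [B15] — A2 WITNESS AT PRINT's [II] (2.3) DATUM: THE BODIES OF THE (E∕U) NAMED FACT, THE SUPPLY TOKEN AND THE LIFT TOKEN OVER `(bd, Dat)` (`Literature/…/B11Thm1ExistsUniqueTokensGB`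
# ✓p767125) HOLD AT THE FLAT DATUM `W := M˙(1)` AT `bd := Node00.lamDatum F` (`B15DeterminingSetsB.lamBondsSeq`), FOR EVERY SEPARATED INDEX — the print-datum twin of the lane's (b)-datum
# certificates ✓p744645 (`…N12Thm1EUAtFlatDatumAllIndices` §2–§3) and ✓p759453∕✓p760654 (`…N12EUStepTokensAtFlatDatum` §1, §3, §4), over dag-n12-w6's print-datum rigidity ✓p768460
# (`…N12FlatDatumRigidityNestedLam`) and the lane's truncation data ✓p767704 (`B11Thm1ExistsUniqueTruncationData`)

Cell `pub-ymgap` (HUMAN RULINGS D-0062 ∕ D-0149), lane `pub-ymgap-dag-n12-c` g34 (R134 seat (a), N12 = [B15], s1, lane owner).  `--kind proof --supports stmt-QuantumFields-27364 --as helper`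
(K1⁹; count-neutral).  HONEST FRAMING: a NON-VACUITY certificate at ONE datum (the flat one) for named `Prop`s that nobody asserts, at the print instance `(lamDatum F, ·)`; nothing of
Bałaban's analysis asserted or refuted; N12 NOT discharged; K0⁷ ∕ K1⁹ OPEN; one finite 𝕋⁴ programme at fixed ε; nothing continuum ∕ OS ∕ mass gap ∕ Clay.  THEOREMS ONLY (0 `def`, 0 `sorry`).
Imports are green today and «seam-cone ∕ stale-green» in the Stage-2 window (dag-n12-w6's LOCATED-GREEN 10:08Z: ✓p744645's closure holds the seam `Node00/Record13CoP` but none of the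
breaker seeds; it re-elaborates unchanged at the re-feed) — filed BEFORE the 13:30Z seam edit.

WHY (dag-n12-d INTENT-112 `…N12Thm1NamesBInhabitedAtGridGuardLam`: at print's datum and K0⁷'s grid guard the (R)-name is now INHABITED hypothesis-free, and the (E∕U) name follows from the
lane's three tokens ᴮ ONLY).  Before an (E∕U) producer item is filed at `lamDatum`, the tokens must pass the A2 test the (b)-instances passed (✓p744645 ∕ ✓p759453): their CONCLUSIONS hold at
the flat datum for every separated index.  The first gate — connectivity of the print-datum tower-site graph — is dag-n12-w6's ✓p767987; the rigidity it yields is ✓p768460; this file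
composes them with the lane's (14) bookkeeping over a bond datum (✓p767234 `ApproxMinTopB`) and the truncation data at print's datum (✓p767704 `lamBondsSeq_succ_subset_truncSeq ∕
lamBondsSeq_truncSeq_top`).  Compared with the (b)-certificates exactly ONE thing changes: the constrained bonds are `lamBondsSeq s.Ω k j ⊆ bondsOf (genSet s.Ω k j)` (inward connectors
dropped) — fewer constraints in the hypotheses (minimisers agree with `M˙1` on fewer bonds) AND in the conclusions (tower-centrality on fewer bonds; (14)'s agreement on fewer bonds).

WHAT.
* §1 `isMinimizerB_one_avgFamily_one` (the flat configuration is a (2.12) minimiser for the flat datum over ANY bond datum and any class containing it) · `segments_of_agreeOnB_one` (a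
  holonomy-flat `U` agreeing with `M˙1` on the bonds of `𝔅` has trivial straight transporters there — dag-n12-w6's `segments_of_agreeOn_one`, bondwise).
* §2 ★★★ `thm1EU_clause_at_flatDatum_lamBondsSeq_of_seq`: for every separated cube-class index (`1 ≤ k`, `k+1 ≤ m+K`, `1 ≤ M₁`) and any class `reg ∋ 1`: (E) `1` is an `IsMinimizerB …
  (lamBondsSeq s.Ω k) (M˙1)`-minimiser; (U) any two such minimisers are related by a gauge transformation EQUAL and CENTRAL at the two tower sites of every bond of `lamBondsSeq s.Ω k j`,
  `j ≤ k` (✓p744645 §2's proof with dag-n12-w6's `exists_towerCentral_gauge_of_flat_segments_lamBondsSeq`).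
* §3 ★★★ `variationalThm1EUSepTop7MGB_body_at_flatDatum_lamDatum` (+ `…CoP…`): the (E∕U) NAME's conclusion at `(bd := lamDatum F)`, `W := M˙(1)`, every index of record `s : SeqOfRecord F
  ν M g K k`, `0 < k`, `k+1 ≤ m+K`, separated, `0 < ν.M₁`, any `Sup`, any `ε₀ > 0`.
* §4 `approxMinTopB_one_flat` (any `𝔅`) · ★ `approxMinimiserExistsTop7MGB_body_at_flatDatum` (the SUPPLY token's conclusion at `W := M˙1`, ANY bond-datum family `bd`).
* §5 ★★ `variationalThm1EULiftTop7MGB_body_at_flatDatum_lamDatum` (+ `…CoP…`, + `…_binders_inhabited_flat`): the LIFT token's conclusion at `bd := lamDatum F`, `Dat := dataSmall7PTopOf F N`,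
  witnesses `(ε₀, δ, M˙1)`, for every regular minimiser `U` of the TRUNCATED flat problem constrained on `lamBondsSeq (truncSeq s).Ω k` — (14) on `lamBondsSeq s.Ω (k+1)`: below the top by
  ✓p767704 `agreeOnB_lamBondsSeq_below_of_truncSeq` (`Λ_j ⊆ Λ′_j`), at the top by the averaging locality + ✓p759453 §2 exactly as before (`Λ_{k+1} = st(Ω_{k+1}^{(k+1)})`, `Λ′_k =
  st(Ω_k^{(k)})`: the tops carry no exclusion); regularity thresholds `2L³ ≤ C₁` as before.

[15] Thm 1 p.279, (2)–(7) p.278, (11)–(14) pp.279–280; [Balaban1984PropagatorsII] (2.3) p.224; [Balaban1988Convergent] (2.1)–(2.2), (2.10)–(2.13), (2.18) pp.254–257; [Balaban1985RegularSpaces] (1.3)–(1.9) p.77.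
-/

noncomputable section

open scoped Matrix.Norms.L2Operator
namespace Summit.QuantumFields.YangMills.BalabanUVNodes.N12EUStepTokensAtFlatDatumLam

open Set
open Literature.MathematicalPhysics.QuantumFieldTheory.Balaban1983to89
open Literature.MathematicalPhysics.QuantumFieldTheory.Balaban1983to89.Node00
open B15DeterminingSets (DetSet pts mem_pts bondsOf embIter genSet gammaRegion gammaRegion_self AgreeOn avgFamily IsMinimizer MSField)
open B15DeterminingSetsB (BDetSet AgreeOnB IsMinimizerB lamBondsSeq lamBondsSeq_top)
open B14.Eq22Determines (IsBlockUnion)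
open B14.Eq213MaximalDomains (side)
open B5Eq117TorusCarriers (Mk)
open B8Eq17ClassAkV1 (plaqsOf plaqsOf_mono)
open B16Sect1Backgrounds (toMS)
open T4Continuum (T4Family walk walkEnd holAt netDisp Letter)
open GaugeField (gaugeAct)
open BlockAveraging (blockAvg)
open ExpMeanLog (expMeanLogSU)
open B11Thm1ExistsUniqueTokensGB (ApproxMinTopB approxMinTop_iff_B)
open B11Thm1ExistsUniqueInductionG (truncSeq truncSeq_Ω_of_le lamBondsSeq_succ_subset_truncSeq lamBondsSeq_truncSeq_top lamBondsSeq_succ_top agreeOnB_lamBondsSeq_below_of_truncSeq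
  omegaPlaqsTop_truncSeq_of_le omegaBondsTop_truncSeq_of_le omegaPlaqsTop_succ_subset_truncSeq omegaBondsTop_succ_subset_truncSeq suppDomOfRecord_truncSeq)
open Summit.QuantumFields.YangMills.Theorems.Prop7FlatHolonomy (iter_blockAvg_eq_straightIter_of_flat)
open Summit.QuantumFields.YangMills.BalabanUVNodes.N12FlatDatumRigidityNestedLam (exists_towerCentral_gauge_of_flat_segments_lamBondsSeq)
open Summit.QuantumFields.YangMills.BalabanUVNodes.N12Thm1RowAtFlatDatum (holFlat_of_wilsonAction4_le_one letterBudget_atRecord plaqSmallOn_one)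
open Summit.QuantumFields.YangMills.BalabanUVNodes.N12Thm1EUAtFlatDatumAllIndices (isBlockUnion_seq sep_of_seqSeparated pow_dvd_side pow_dvd_dCubeSide dataSmall7PTop_flatDatum)
open Summit.QuantumFields.YangMills.BalabanUVNodes.N12EUStepTokensAtFlatDatum (approxMinTop_one_flat embIter_mem_of_blockOf_eq_endpoint)
open B15Claim189PinNonVacuity (wilsonAction4_unit)
open B15Prop1Thm1LetterLengthZero (mem_class_of_flat)
open Summit.QuantumFields.YangMills.Theorems.K0TopIndexWrapGeometry (exists_seq_top)

/-! ## §0  Numerics of the lattices of record -/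

section Numerics

variable (P : Params)

/-- `0 < η_j` on the lattices of record. [cite: Balaban1987RG1, (1.1) p.260 (bookkeeping)] -/
private theorem eta_pos (j : ℕ) : 0 < P.eta j := pow_pos (inv_pos.mpr (Nat.cast_pos.mpr P.L_pos)) j

/-- `η_j = L · η_{j+1}`. [cite: Balaban1987RG1, (1.1) p.260 (bookkeeping)] -/
private theorem eta_eq_L_mul_eta_succ (j : ℕ) : P.eta j = (P.L : ℝ) * P.eta (j + 1) := by
  have hL : (P.L : ℝ) ≠ 0 := Nat.cast_ne_zero.mpr P.L_pos.ne'
  unfold Params.eta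
  rw [pow_succ, mul_comm ((P.L : ℝ)⁻¹ ^ j), ← mul_assoc, mul_inv_cancel₀ hL, one_mul]

/-- The trivial configuration has trivial holonomy along every step sequence (private bookkeeping, as in dag-n12-w6's `…N12Thm1RowAtFlatDatum`). [cite: Balaban1985Averaging, (9) p.19 (bookkeeping)] -/
private theorem holAt_one_eq_one' {G : Type*} [GaugeGroup G] {j : ℕ} : ∀ γ : List (T4Continuum.LStep P j), holAt (1 : GaugeField P j G) γ = 1
  | [] => T4Continuum.holAt_nil _
  | s :: γ => by
    rw [T4Continuum.holAt_cons, holAt_one_eq_one' γ, mul_one]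
    show (if s.fwd then (1 : G) else (1 : G)⁻¹) = 1
    split <;> simp

end Numerics

/-! ## §1  The flat configuration over a bond datum -/

section FlatB

variable {P : Params} {N : ℕ} [NeZero N]

/-- **THE FLAT CONFIGURATION IS A (2.12) MINIMISER FOR THE FLAT DATUM OVER ANY BOND DATUM** and any class containing it: `A(1) = 0 ≤ A(U)` (twin of dag-n12-e's `isMinimizer_one_avgFamily_one`).
[cite: Balaban1988Convergent, (2.12) p.256; Balaban1987RG1, (0.2) p.252] -/
theorem isMinimizerB_one_avgFamily_one (av : ∀ j, Averaging P j (SU N)) {reg : Set (GaugeField P 0 (SU N))} (h1 : (1 : GaugeField P 0 (SU N)) ∈ reg) (𝔅 : BDetSet P) :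
    IsMinimizerB av reg 𝔅 (avgFamily av 1) 1 := by
  refine ⟨h1, fun _ _ _ => rfl, fun U _ _ => ?_⟩
  rw [wilsonAction4_unit]
  exact wilsonAction4_nonneg U

variable {F : T4Family} {Kt : ℕ}

/-- **THE CONSTRAINT `M˙U = M˙1` ON THE BONDS OF `𝔅` MAKES THE STRAIGHT TRANSPORTERS OF A HOLONOMY-FLAT `U` TRIVIAL THERE** — dag-n12-w6's `segments_of_agreeOn_one`, bondwise over a bond
datum (the proof reads the constraint one bond at a time). [cite: Balaban1987RG1, (0.4) p.253, (0.11) p.253; Balaban1988Convergent, (2.10)–(2.12) p.256] -/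
theorem segments_of_agreeOnB_one (𝔅 : BDetSet (F.P Kt)) (U : GaugeField (F.P Kt) 0 (SU N))
    (hflat : ∀ (x : Site (F.P Kt) 0) (w : List (Letter (F.P Kt).d)), (∀ ν, netDisp w ν = 0) → holAt U (walk x w) = 1)
    (hagree : AgreeOnB 𝔅 (avgFamily (avOfRecord F N Kt) U) (avgFamily (avOfRecord F N Kt) 1)) :
    ∀ j, ∀ c ∈ 𝔅 j, holAt U (walk (embIter j c.src) (List.replicate ((F.P Kt).L ^ j) (c.dir, true))) = 1 := by
  intro j c hc
  have hflat1 : ∀ (x : Site (F.P Kt) 0) (w : List (Letter (F.P Kt).d)), (∀ ν, netDisp w ν = 0) → holAt (1 : GaugeField (F.P Kt) 0 (SU N)) (walk x w) = 1 :=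
    fun _ _ _ => holAt_one_eq_one' _ _
  have ha : Averaging.iter (fun i => (blockAvg expMeanLogSU : Averaging (F.P Kt) i (SU N))) j U c =
      Averaging.iter (fun i => (blockAvg expMeanLogSU : Averaging (F.P Kt) i (SU N))) j 1 c := hagree j c hc
  rw [iter_blockAvg_eq_straightIter_of_flat expMeanLogSU T3DescentFibreTower.expMeanLogSU_E_one U hflat j,
    iter_blockAvg_eq_straightIter_of_flat expMeanLogSU T3DescentFibreTower.expMeanLogSU_E_one 1 hflat1 j] at ha
  dsimp only at ha
  rw [holAt_one_eq_one'] at ha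
  exact ha

end FlatB

/-! ## §2  The (E∕U) clause at the flat datum for every separated cube-class index, at print's datum -/

section Clause

variable {F : T4Family} {N : ℕ} [NeZero N] {Kt : ℕ}

/-- ★★★ **[15] THM 1's EXISTENCE ∕ UNIQUENESS CLAUSE AT THE FLAT DATUM AND PRINT's [II] (2.3) DATUM, FOR EVERY SEPARATED (2.18) INDEX OVER A CLASS OF ALIGNED CUBE UNIONS** (twin of ✓p744645
§2 with `lamBondsSeq s.Ω k` for `genSet s.Ω k`): (E) `1` is a (2.12) minimiser for the datum `M˙(1)` on `Λ(s.Ω, k)`; (U) any two such minimisers are related `U₁^u = U₂` with `toMS u j`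
EQUAL and CENTRAL at the two tower sites of every bond of `Λ_j`, `j ≤ k` — holonomy-flatness from `A(U_i) ≤ A(1)`, trivial straight transporters on `Λ`'s bonds (§1), then dag-n12-w6's
print-datum rigidity `exists_towerCentral_gauge_of_flat_segments_lamBondsSeq` under (N)(B)(S). [cite: Balaban1985Variational, Thm 1 p.279, (3)–(4) p.278; Balaban1984PropagatorsII, (2.3) p.224; Balaban1988Convergent, (2.2) p.255, (2.10)–(2.13) pp.256–257, (2.18) p.257; Balaban1985RegularSpaces, (1.3)–(1.6) p.77] -/
theorem thm1EU_clause_at_flatDatum_lamBondsSeq_of_seq {D : ℕ → Set (Set (Site (F.P Kt) 0))} {σ : ℕ → ℕ}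
    (hD : ∀ j, D j ⊆ unionsOfCubes (F.P Kt) (σ j)) (hσ : ∀ j, (F.P Kt).L ^ j ∣ σ j)
    {k : ℕ} (hk1 : 1 ≤ k) (hkK : k + 1 ≤ (F.P Kt).m + (F.P Kt).K) {M₁ : ℕ} (hM₁ : 1 ≤ M₁)
    (s : B14.Eq218Concrete.Seq D k) (hsep : Sect2.SeqSeparated M₁ s)
    (reg : Set (GaugeField (F.P Kt) 0 (SU N))) (h1 : (1 : GaugeField (F.P Kt) 0 (SU N)) ∈ reg) :
    IsMinimizerB (avOfRecord F N Kt) reg (lamBondsSeq s.Ω k) (avgFamily (avOfRecord F N Kt) 1) 1 ∧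
      ∀ U₁ U₂ : GaugeField (F.P Kt) 0 (SU N),
        IsMinimizerB (avOfRecord F N Kt) reg (lamBondsSeq s.Ω k) (avgFamily (avOfRecord F N Kt) 1) U₁ →
        IsMinimizerB (avOfRecord F N Kt) reg (lamBondsSeq s.Ω k) (avgFamily (avOfRecord F N Kt) 1) U₂ →
        ∃ u : GaugeTransf (F.P Kt) 0 (SU N),
          (∀ j, j ≤ k → ∀ b ∈ lamBondsSeq s.Ω k j, toMS u j b.src = toMS u j b.tgt ∧ ∀ g : SU N, toMS u j b.src * g = g * toMS u j b.src) ∧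
            gaugeAct u U₁ = U₂ := by
  have hk : k ≤ (F.P Kt).m + (F.P Kt).K := by omega
  have hone : IsMinimizerB (avOfRecord F N Kt) reg (lamBondsSeq s.Ω k) (avgFamily (avOfRecord F N Kt) 1) 1 := isMinimizerB_one_avgFamily_one _ h1 _
  refine ⟨hone, fun U₁ U₂ hU₁ hU₂ => ?_⟩
  -- both minimisers are holonomy-flat with trivial straight transporters on the bonds of `Λ`
  have hflat₁ := holFlat_of_wilsonAction4_le_one U₁ (hU₁.2.2 1 hone.1 hone.2.1)
  have hflat₂ := holFlat_of_wilsonAction4_le_one U₂ (hU₂.2.2 1 hone.1 hone.2.1)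
  have hseg₁ := segments_of_agreeOnB_one (lamBondsSeq s.Ω k) U₁ hflat₁ hU₁.2.1
  have hseg₂ := segments_of_agreeOnB_one (lamBondsSeq s.Ω k) U₂ hflat₂ hU₂.2.1
  exact exists_towerCentral_gauge_of_flat_segments_lamBondsSeq hk1 hk (fun j h1' hj => s.chain.Ω_succ_subset_Ω h1' hj)
    (isBlockUnion_seq hD hσ hk s) (sep_of_seqSeparated hM₁ hk hsep) (letterBudget_atRecord hkK) U₁ U₂
    hflat₁ (fun j _ c hc => hseg₁ j c hc) hflat₂ (fun j _ c hc => hseg₂ j c hc)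

end Clause

/-! ## §3  The (E∕U) name's body at `bd := lamDatum F`, every index of record -/

section Letters

variable {F : T4Family} {N : ℕ} [NeZero N]

/-- ★★★ **THE BODY OF `B11Thm1ExistsUniqueTokensGB.VariationalThm1EUSepTop7MGB F N Sup Adm (lamDatum F) Dat …` AT THE FLAT DATUM, EVERY INDEX OF RECORD**: for every numerics `ν` with `0 < ν.M₁`,
cube letter `M`, history `g`, torus `K`, budgeted length `0 < k`, `k + 1 ≤ m + K`, separated index `s : SeqOfRecord F ν M g K k`, any selector `Sup` and any `ε₀ > 0`, at `W := M˙(1)` the name's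
CONCLUSION holds at print's datum `lamDatum F K k s.Ω = lamBondsSeq s.Ω k`: a minimiser over the class (6) at `ε₀` exists (`U₀ := 1`) and any two minimisers are tower-centrally gauge
related on `Λ`'s bonds.  (Twin of ✓p744645 `variationalThm1EUSepTop7MG_body_at_flatDatum`.) [cite: Balaban1985Variational, Thm 1 p.279, (1) p.277, (2)–(4), (6) p.278; Balaban1984PropagatorsII, (2.3) p.224; Balaban1988Convergent, (2.1) p.254, (2.2) p.255, (2.12) p.256, (2.18) p.257; Balaban1985RegularSpaces, (1.3)–(1.9) p.77] -/
theorem variationalThm1EUSepTop7MGB_body_at_flatDatum_lamDatum (Sup : (ν : Stage7Numerics) → (K : ℕ) → (ℕ → Set (Site (F.P K) 0)) → Set (Site (F.P K) 0))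
    (ν : Stage7Numerics) (M : ℕ) (g : ℕ → ℝ) (K k : ℕ) (s : SeqOfRecord F ν M g K k) (hk0 : 0 < k) (hkK : k + 1 ≤ (F.P K).m + (F.P K).K)
    (hsep : Sect2.SeqSeparated ν.M₁ s) (hM : 0 < ν.M₁) {ε₀ : ℝ} (hε₀ : 0 < ε₀) :
    (∃ U₀ : GaugeField (F.P K) 0 (SU N), IsMinimizerB (avOfRecord F N K)
        {U | (∀ n, n ≤ k → PlaqSmallOn (Sect2.omegaPlaqsTop s.Ω (Sup ν K s.Ω) n) (ε₀ * (F.P K).eta n ^ 2) U) ∧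
          Sect2.CoDivClassOnTop s.Ω (Sup ν K s.Ω) k ε₀ U} (lamDatum F K k s.Ω) (avgFamily (avOfRecord F N K) 1) U₀) ∧
    ∀ U₁ U₂ : GaugeField (F.P K) 0 (SU N),
      IsMinimizerB (avOfRecord F N K)
          {U | (∀ n, n ≤ k → PlaqSmallOn (Sect2.omegaPlaqsTop s.Ω (Sup ν K s.Ω) n) (ε₀ * (F.P K).eta n ^ 2) U) ∧
            Sect2.CoDivClassOnTop s.Ω (Sup ν K s.Ω) k ε₀ U} (lamDatum F K k s.Ω) (avgFamily (avOfRecord F N K) 1) U₁ →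
      IsMinimizerB (avOfRecord F N K)
          {U | (∀ n, n ≤ k → PlaqSmallOn (Sect2.omegaPlaqsTop s.Ω (Sup ν K s.Ω) n) (ε₀ * (F.P K).eta n ^ 2) U) ∧
            Sect2.CoDivClassOnTop s.Ω (Sup ν K s.Ω) k ε₀ U} (lamDatum F K k s.Ω) (avgFamily (avOfRecord F N K) 1) U₂ →
      ∃ u : GaugeTransf (F.P K) 0 (SU N),
        (∀ n, n ≤ k → ∀ b ∈ lamDatum F K k s.Ω n, toMS u n b.src = toMS u n b.tgt ∧ ∀ g : SU N, toMS u n b.src * g = g * toMS u n b.src) ∧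
          gaugeAct u U₁ = U₂ := by
  have h1 := mem_class_of_flat (U := (1 : GaugeField (F.P K) 0 (SU N))) (fun p => by simp [GaugeField.plaqHol]) s.Ω (Sup ν K s.Ω) k hε₀
  obtain ⟨hE, hU⟩ := thm1EU_clause_at_flatDatum_lamBondsSeq_of_seq (F := F) (N := N) (Kt := K) (D := DOfRecord F ν M g K)
    (σ := fun j => dCubeSide (F.P K).L M (RkOfRecord (F.P K).L ν.r (g j)) j) (fun _ => subset_rfl) (fun j => pow_dvd_dCubeSide _ _ _ j) hk0 hkK hM s hsep _ h1
  exact ⟨⟨1, hE⟩, hU⟩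

/-- ★★★ **`CoP` EDITION** — the body of `VariationalThm1EUSepCoP7MGB F N Adm (lamDatum F) Dat …` (node00-def-R's selector `suppDomOfRecord`) at the flat datum, every index of record: the form
dag-n12-d's INTENT-112 assembles at K0⁷'s grid guard. [cite: Balaban1985Variational, Thm 1 p.279; Balaban1984PropagatorsII, (2.3) p.224; Balaban1988Convergent, p.255, (2.12) p.256] -/
theorem variationalThm1EUSepCoP7MGB_body_at_flatDatum_lamDatum (ν : Stage7Numerics) (M : ℕ) (g : ℕ → ℝ) (K k : ℕ) (s : SeqOfRecord F ν M g K k) (hk0 : 0 < k)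
    (hkK : k + 1 ≤ (F.P K).m + (F.P K).K) (hsep : Sect2.SeqSeparated ν.M₁ s) (hM : 0 < ν.M₁) {ε₀ : ℝ} (hε₀ : 0 < ε₀) :
    (∃ U₀ : GaugeField (F.P K) 0 (SU N), IsMinimizerB (avOfRecord F N K)
        {U | (∀ n, n ≤ k → PlaqSmallOn (Sect2.omegaPlaqsTop s.Ω (suppDomOfRecord F ν K s.Ω) n) (ε₀ * (F.P K).eta n ^ 2) U) ∧
          Sect2.CoDivClassOnTop s.Ω (suppDomOfRecord F ν K s.Ω) k ε₀ U} (lamDatum F K k s.Ω) (avgFamily (avOfRecord F N K) 1) U₀) ∧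
    ∀ U₁ U₂ : GaugeField (F.P K) 0 (SU N),
      IsMinimizerB (avOfRecord F N K)
          {U | (∀ n, n ≤ k → PlaqSmallOn (Sect2.omegaPlaqsTop s.Ω (suppDomOfRecord F ν K s.Ω) n) (ε₀ * (F.P K).eta n ^ 2) U) ∧
            Sect2.CoDivClassOnTop s.Ω (suppDomOfRecord F ν K s.Ω) k ε₀ U} (lamDatum F K k s.Ω) (avgFamily (avOfRecord F N K) 1) U₁ →
      IsMinimizerB (avOfRecord F N K)
          {U | (∀ n, n ≤ k → PlaqSmallOn (Sect2.omegaPlaqsTop s.Ω (suppDomOfRecord F ν K s.Ω) n) (ε₀ * (F.P K).eta n ^ 2) U) ∧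
            Sect2.CoDivClassOnTop s.Ω (suppDomOfRecord F ν K s.Ω) k ε₀ U} (lamDatum F K k s.Ω) (avgFamily (avOfRecord F N K) 1) U₂ →
      ∃ u : GaugeTransf (F.P K) 0 (SU N),
        (∀ n, n ≤ k → ∀ b ∈ lamDatum F K k s.Ω n, toMS u n b.src = toMS u n b.tgt ∧ ∀ g : SU N, toMS u n b.src * g = g * toMS u n b.src) ∧
          gaugeAct u U₁ = U₂ :=
  variationalThm1EUSepTop7MGB_body_at_flatDatum_lamDatum (fun ν K Ω => suppDomOfRecord F ν K Ω) ν M g K k s hk0 hkK hsep hM hε₀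

end Letters

/-! ## §4  The SUPPLY token's body at the flat datum, ANY bond datum -/

section Supply

variable {P : Params} {N : ℕ} [NeZero N]

/-- **(14) AT THE FLAT DATUM OVER ANY BOND DATUM**: the flat configuration `1` is an approximate minimiser with (14) for the datum `M˙(1)` at every positive threshold — regularity as in
✓p759453 `approxMinTop_one_flat`, agreement with its own averages on ANY bond set. [cite: Balaban1985Variational, (14) p.280, (2)–(3) p.278; Balaban1984PropagatorsII, (2.3) p.224] -/
theorem approxMinTopB_one_flat (av : ∀ j, Averaging P j (SU N)) (Ω : ℕ → Set (Site P 0)) (Ω₀ : Set (Site P 0)) (k : ℕ) {ρ : ℕ → ℝ} (hρ : ∀ n, n ≤ k → 0 < ρ n)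
    (𝔅 : BDetSet P) : ApproxMinTopB av Ω Ω₀ k ρ 𝔅 (avgFamily av 1) 1 :=
  have h := (approxMinTop_iff_B av Ω Ω₀ k ρ (avgFamily av 1) 1).1 (approxMinTop_one_flat av Ω Ω₀ k hρ)
  ⟨h.1, h.2.1, fun _ _ _ => rfl⟩

variable {F : T4Family}

/-- ★ **THE SUPPLY TOKEN's BODY AT THE FLAT DATUM, ANY BOND-DATUM FAMILY** (`ApproxMinimiserExistsTop7MGB F N Sup Adm bd Dat C₁ …`'s conclusion at `W := M˙(1)`): an approximate minimiser
with (14) over `bd K k Ω` at the thresholds `C₁B₃δ_n` EXISTS (`U₀ := 1`) as soon as `0 < C₁`, `0 < B₃`, `0 < δ_n`; in particular at print's `lamDatum F`. [cite: Balaban1985Variational, (11) p.279, (14) p.280; Balaban1984PropagatorsII, (2.3) p.224] -/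
theorem approxMinimiserExistsTop7MGB_body_at_flatDatum (bd : BondDatum F) (K : ℕ) (Ω : ℕ → Set (Site (F.P K) 0)) (Ω₀ : Set (Site (F.P K) 0)) (k : ℕ) {C₁ B₃ : ℝ}
    {δ : ℕ → ℝ} (hC : 0 < C₁) (hB : 0 < B₃) (hδ : ∀ n, n ≤ k → 0 < δ n) :
    ∃ U₀ : GaugeField (F.P K) 0 (SU N), ApproxMinTopB (avOfRecord F N K) Ω Ω₀ k (fun n => C₁ * B₃ * δ n) (bd K k Ω) (avgFamily (avOfRecord F N K) 1) U₀ :=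
  ⟨1, approxMinTopB_one_flat _ Ω Ω₀ k (fun n hn => mul_pos (mul_pos hC hB) (hδ n hn)) _⟩

end Supply

/-! ## §5  The LIFT token's body at the flat datum at `bd := lamDatum F` -/

section Lift

variable {F : T4Family} {N : ℕ} [NeZero N]

/-- ★★ **THE LIFT TOKEN's BODY AT THE FLAT DATUM AND PRINT's DATUM, EVERY SEPARATED INDEX, ANY SELECTOR READ THROUGH `Ω_1`** (`VariationalThm1EULiftTop7MGB F N Sup Adm (lamDatum F)
(dataSmall7PTopOf F N) C₁ …`'s conclusion at `W := M˙(1)`; twin of ✓p759453 §3): for an index `s` of length `k+1` with `0 < k`, `k+1 ≤ m+K`, separated with `1 ≤ ν.M₁`, thresholds `δ_n` in the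
numeric range, `0 ≤ B₃` and `2·L³ ≤ C₁`, the witnesses `ε₀′ := ε₀`, `δ′ := δ`, `V₀ := M˙(1)` satisfy the numeric rows, the record's (7) for the truncated problem, and — FOR EVERY (8)-regular
minimiser `U` of the truncated flat problem constrained on `Λ(truncSeq s, k)` — (14) at length `k+1` over `Λ(s, k+1)` for the flat datum: the class ranges at the scales `≤ k` coincide, the top
ranges sit inside the scale-`k` ones (factors `2L²` ∕ `2L³`), agreement BELOW the top by `Λ_j ⊆ Λ′_j` (✓p767704), AT the top by the averaging locality + ✓p759453 §2 on `Λ′_k = st(Ω_k^{(k)})`.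
[cite: Balaban1985Variational, (11) p.279, (12)–(14) p.280, Thm 1 p.279; Balaban1984PropagatorsII, (2.3) p.224; Balaban1985RegularSpaces, (1.3)–(1.9) p.77; Balaban1988Convergent, (2.1) p.254, (2.2) p.255, (2.10)–(2.12) p.256; Balaban1987RG1, (0.4) p.253] -/
theorem variationalThm1EULiftTop7MGB_body_at_flatDatum_lamDatum
    (Sup : (ν : Stage7Numerics) → (K : ℕ) → (ℕ → Set (Site (F.P K) 0)) → Set (Site (F.P K) 0))
    (ν : Stage7Numerics) (M : ℕ) (g : ℕ → ℝ) (K k : ℕ) (s : SeqOfRecord F ν M g K (k + 1))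
    (hk0 : 0 < k) (hkK : k + 1 ≤ (F.P K).m + (F.P K).K) (hsep : Sect2.SeqSeparated ν.M₁ s) (hM : 0 < ν.M₁)
    (hSup : Sup ν K (truncSeq s).Ω = Sup ν K s.Ω)
    {ε₀ C₁ B₃ a₀ a₁ : ℝ} {δ : ℕ → ℝ}
    (hnum : ∀ n, n ≤ k + 1 → 0 < δ n ∧ δ n ≤ a₁ ∧ B₃ * δ n ≤ ε₀) (hc : ∀ n, n < k + 1 → δ n ≤ 2 * δ (n + 1))
    (hc' : ∀ n, n < k + 1 → δ (n + 1) ≤ 2 * δ n) (hε : ε₀ ≤ a₀) (hB₃ : 0 ≤ B₃) (hC₁ : 2 * ((F.P K).L : ℝ) ^ 3 ≤ C₁) :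
    ∃ (ε₀' : ℝ) (δ' : ℕ → ℝ) (V₀ : MSField (F.P K) (SU N)),
      (∀ n, n ≤ k → 0 < δ' n ∧ δ' n ≤ a₁ ∧ B₃ * δ' n ≤ ε₀') ∧ (∀ n, n < k → δ' n ≤ 2 * δ' (n + 1)) ∧ (∀ n, n < k → δ' (n + 1) ≤ 2 * δ' n) ∧ ε₀' ≤ a₀ ∧
      dataSmall7PTopOf F N K (truncSeq s).Ω (Sup ν K (truncSeq s).Ω) k δ' V₀ ∧
      ∀ U : GaugeField (F.P K) 0 (SU N),
        IsMinimizerB (avOfRecord F N K)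
            {U | (∀ n, n ≤ k → PlaqSmallOn (Sect2.omegaPlaqsTop (truncSeq s).Ω (Sup ν K (truncSeq s).Ω) n) (ε₀' * (F.P K).eta n ^ 2) U) ∧
              Sect2.CoDivClassOnTop (truncSeq s).Ω (Sup ν K (truncSeq s).Ω) k ε₀' U} (lamDatum F K k (truncSeq s).Ω) V₀ U →
        ((∀ n, n ≤ k → PlaqSmallOn (Sect2.omegaPlaqsTop (truncSeq s).Ω (Sup ν K (truncSeq s).Ω) n) (B₃ * δ' n * (F.P K).eta n ^ 2) U) ∧
          ∀ n, n ≤ k → Sect2.CoDivSmallOn (Sect2.omegaBondsTop (truncSeq s).Ω (Sup ν K (truncSeq s).Ω) n) (B₃ * δ' n * (F.P K).eta n ^ 3) U) →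
        ApproxMinTopB (avOfRecord F N K) s.Ω (Sup ν K s.Ω) (k + 1) (fun n => C₁ * B₃ * δ n) (lamDatum F K (k + 1) s.Ω) (avgFamily (avOfRecord F N K) 1) U := by
  refine ⟨ε₀, δ, avgFamily (avOfRecord F N K) 1, fun n hn => hnum n (by omega), fun n hn => hc n (by omega), fun n hn => hc' n (by omega), hε,
    dataSmall7PTop_flatDatum K _ _ k (fun n hn => (hnum n (by omega)).1), fun U hU h8 => ?_⟩
  -- numerics
  have hL1 : (1 : ℝ) ≤ (F.P K).L := by exact_mod_cast (F.P K).L_pos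
  have hL0 : (0 : ℝ) ≤ (F.P K).L := zero_le_one.trans hL1
  have hC3 : 2 * ((F.P K).L : ℝ) ^ 2 ≤ C₁ := le_trans (by nlinarith [pow_le_pow_right₀ hL1 (show 2 ≤ 3 by norm_num)]) hC₁
  have hC1 : (1 : ℝ) ≤ C₁ := le_trans (by nlinarith [one_le_pow₀ (M₀ := ℝ) hL1 (n := 3)]) hC₁
  have hη : ∀ j, 0 ≤ (F.P K).eta j := fun j => (eta_pos (F.P K) j).le
  have hδ0 : ∀ n, n ≤ k + 1 → 0 ≤ δ n := fun n hn => (hnum n hn).1.le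
  have hM₁ : 1 ≤ ν.M₁ := hM
  -- the class ranges at the scales `≤ k` coincide; the top ranges sit inside the scale-`k` ones (✓p767704 §4)
  have hΩP : ∀ n, n ≤ k → Sect2.omegaPlaqsTop s.Ω (Sup ν K s.Ω) n = Sect2.omegaPlaqsTop (truncSeq s).Ω (Sup ν K (truncSeq s).Ω) n := by
    intro n hn; rw [hSup, omegaPlaqsTop_truncSeq_of_le s _ hn]
  have hΩB : ∀ n, n ≤ k → Sect2.omegaBondsTop s.Ω (Sup ν K s.Ω) n = Sect2.omegaBondsTop (truncSeq s).Ω (Sup ν K (truncSeq s).Ω) n := by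
    intro n hn; rw [hSup, omegaBondsTop_truncSeq_of_le s _ hn]
  have hPtop : Sect2.omegaPlaqsTop s.Ω (Sup ν K s.Ω) (k + 1) ⊆ Sect2.omegaPlaqsTop (truncSeq s).Ω (Sup ν K (truncSeq s).Ω) k := by
    rw [hSup]; exact omegaPlaqsTop_succ_subset_truncSeq s hk0 _
  have hBtop : Sect2.omegaBondsTop s.Ω (Sup ν K s.Ω) (k + 1) ⊆ Sect2.omegaBondsTop (truncSeq s).Ω (Sup ν K (truncSeq s).Ω) k := by
    rw [hSup]; exact omegaBondsTop_succ_subset_truncSeq s hk0 _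
  -- thresholds: `B₃δ_n ≤ C₁B₃δ_n` below the top, and `B₃δ_k·η_k^p ≤ C₁B₃δ_{k+1}·η_{k+1}^p` (`p = 2, 3`) at the top
  have hmono : ∀ n, n ≤ k + 1 → ∀ (t : ℝ), 0 ≤ t → B₃ * δ n * t ≤ C₁ * B₃ * δ n * t := by
    intro n hn t ht
    calc B₃ * δ n * t = 1 * (B₃ * δ n * t) := (one_mul _).symm
      _ ≤ C₁ * (B₃ * δ n * t) := mul_le_mul_of_nonneg_right hC1 (mul_nonneg (mul_nonneg hB₃ (hδ0 n hn)) ht)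
      _ = C₁ * B₃ * δ n * t := by ring
  have hηk : (F.P K).eta k = ((F.P K).L : ℝ) * (F.P K).eta (k + 1) := eta_eq_L_mul_eta_succ (F.P K) k
  have hδk : δ k ≤ 2 * δ (k + 1) := hc k (lt_add_one k)
  have htop : ∀ (p : ℕ), 2 * ((F.P K).L : ℝ) ^ p ≤ C₁ →
      B₃ * δ k * (F.P K).eta k ^ p ≤ C₁ * B₃ * δ (k + 1) * (F.P K).eta (k + 1) ^ p := by
    intro p hCp
    have hηp : 0 ≤ (F.P K).eta (k + 1) ^ p := pow_nonneg (hη (k + 1)) p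
    calc B₃ * δ k * (F.P K).eta k ^ p = (B₃ * (F.P K).eta (k + 1) ^ p) * (δ k * ((F.P K).L : ℝ) ^ p) := by rw [hηk, mul_pow]; ring
      _ ≤ (B₃ * (F.P K).eta (k + 1) ^ p) * (2 * δ (k + 1) * ((F.P K).L : ℝ) ^ p) :=
          mul_le_mul_of_nonneg_left (mul_le_mul_of_nonneg_right hδk (pow_nonneg hL0 p)) (mul_nonneg hB₃ hηp)
      _ = (2 * ((F.P K).L : ℝ) ^ p) * (B₃ * δ (k + 1) * (F.P K).eta (k + 1) ^ p) := by ring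
      _ ≤ C₁ * (B₃ * δ (k + 1) * (F.P K).eta (k + 1) ^ p) := mul_le_mul_of_nonneg_right hCp (mul_nonneg (mul_nonneg hB₃ (hδ0 (k + 1) le_rfl)) hηp)
      _ = C₁ * B₃ * δ (k + 1) * (F.P K).eta (k + 1) ^ p := by ring
  refine ⟨fun n hn => ?_, fun n hn => ?_, fun j b hb => ?_⟩
  · -- (14), plaquettes
    rcases Nat.lt_or_ge n (k + 1) with hlt | hge
    · have hn' : n ≤ k := by omega
      rw [hΩP n hn']
      exact fun p hp => (h8.1 n hn' p hp).trans_le (hmono n hn _ (pow_nonneg (hη n) 2))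
    · obtain rfl : n = k + 1 := le_antisymm hn hge
      exact fun p hp => (h8.1 k le_rfl p (hPtop hp)).trans_le (htop 2 hC3)
  · -- (14), co-divergence
    rcases Nat.lt_or_ge n (k + 1) with hlt | hge
    · have hn' : n ≤ k := by omega
      rw [hΩB n hn']
      exact fun b hb => (h8.2 n hn' b hb).trans_le (hmono n hn _ (pow_nonneg (hη n) 3))
    · obtain rfl : n = k + 1 := le_antisymm hn hge
      exact fun b hb => (h8.2 k le_rfl b (hBtop hb)).trans_le (htop 3 hC₁)
  · -- (14), agreement with `M˙(1)` on `Λ(s, k+1)`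
    change b ∈ lamBondsSeq s.Ω (k + 1) j at hb
    rcases Nat.lt_or_ge j (k + 1) with hlt | hge
    · -- below the top: `Λ_j ⊆ Λ′_j` (✓p767704)
      exact agreeOnB_lamBondsSeq_below_of_truncSeq s hk0 hU.2.1 (by omega) hb
    · rcases Nat.eq_or_lt_of_le hge with heq | hgt
      swap
      · -- above the top there is no member
        exfalso
        rw [B15DeterminingSetsB.lamBondsSeq_of_gt s.Ω (k + 1) hgt] at hb
        exact hb
      -- the top scale: locality of the averaging + ✓p759453 §2, on `Λ′_k = st(Ω_k^{(k)})`
      subst heq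
      have hb' : b ∈ bondsOf (pts (k + 1) (s.Ω (k + 1))) := by rwa [lamBondsSeq_succ_top s] at hb
      show (avOfRecord F N K k).avg (Averaging.iter (avOfRecord F N K) k U) b = (avOfRecord F N K k).avg (Averaging.iter (avOfRecord F N K) k 1) b
      refine (avOfRecord F N K k).local_dep hkK _ _ b fun b' hb'src => ?_
      have hmem : embIter k b'.src ∈ s.Ω k := embIter_mem_of_blockOf_eq_endpoint hM₁ hkK (hsep k hk0 (lt_add_one k)) hb' hb'src
      have hb'' : b' ∈ lamBondsSeq (truncSeq s).Ω k k := by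
        rw [lamBondsSeq_truncSeq_top s]
        exact Or.inl hmem
      exact hU.2.1 k b' hb''

/-- ★★ **`CoP` EDITION — THE LIFT TOKEN's BODY AT THE FLAT DATUM ON THE SUPPORT OF RECORD, PRINT's DATUM** (`VariationalThm1EULiftCoP7MGB F N Adm (lamDatum F) (dataSmall7PTopOf F N) …`):
node00-def-R's selector reads `Ω_1` only, which the truncation keeps (✓p767704 `suppDomOfRecord_truncSeq`). [cite: Balaban1985Variational, (11) p.279, (12)–(14) p.280; Balaban1984PropagatorsII, (2.3) p.224; Balaban1988Convergent, p.255, (2.12) p.256] -/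
theorem variationalThm1EULiftCoP7MGB_body_at_flatDatum_lamDatum
    (ν : Stage7Numerics) (M : ℕ) (g : ℕ → ℝ) (K k : ℕ) (s : SeqOfRecord F ν M g K (k + 1))
    (hk0 : 0 < k) (hkK : k + 1 ≤ (F.P K).m + (F.P K).K) (hsep : Sect2.SeqSeparated ν.M₁ s) (hM : 0 < ν.M₁)
    {ε₀ C₁ B₃ a₀ a₁ : ℝ} {δ : ℕ → ℝ}
    (hnum : ∀ n, n ≤ k + 1 → 0 < δ n ∧ δ n ≤ a₁ ∧ B₃ * δ n ≤ ε₀) (hc : ∀ n, n < k + 1 → δ n ≤ 2 * δ (n + 1))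
    (hc' : ∀ n, n < k + 1 → δ (n + 1) ≤ 2 * δ n) (hε : ε₀ ≤ a₀) (hB₃ : 0 ≤ B₃) (hC₁ : 2 * ((F.P K).L : ℝ) ^ 3 ≤ C₁) :
    ∃ (ε₀' : ℝ) (δ' : ℕ → ℝ) (V₀ : MSField (F.P K) (SU N)),
      (∀ n, n ≤ k → 0 < δ' n ∧ δ' n ≤ a₁ ∧ B₃ * δ' n ≤ ε₀') ∧ (∀ n, n < k → δ' n ≤ 2 * δ' (n + 1)) ∧ (∀ n, n < k → δ' (n + 1) ≤ 2 * δ' n) ∧ ε₀' ≤ a₀ ∧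
      dataSmall7PTopOf F N K (truncSeq s).Ω (suppDomOfRecord F ν K (truncSeq s).Ω) k δ' V₀ ∧
      ∀ U : GaugeField (F.P K) 0 (SU N),
        IsMinimizerB (avOfRecord F N K)
            {U | (∀ n, n ≤ k → PlaqSmallOn (Sect2.omegaPlaqsTop (truncSeq s).Ω (suppDomOfRecord F ν K (truncSeq s).Ω) n) (ε₀' * (F.P K).eta n ^ 2) U) ∧
              Sect2.CoDivClassOnTop (truncSeq s).Ω (suppDomOfRecord F ν K (truncSeq s).Ω) k ε₀' U} (lamDatum F K k (truncSeq s).Ω) V₀ U →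
        ((∀ n, n ≤ k → PlaqSmallOn (Sect2.omegaPlaqsTop (truncSeq s).Ω (suppDomOfRecord F ν K (truncSeq s).Ω) n) (B₃ * δ' n * (F.P K).eta n ^ 2) U) ∧
          ∀ n, n ≤ k → Sect2.CoDivSmallOn (Sect2.omegaBondsTop (truncSeq s).Ω (suppDomOfRecord F ν K (truncSeq s).Ω) n) (B₃ * δ' n * (F.P K).eta n ^ 3) U) →
        ApproxMinTopB (avOfRecord F N K) s.Ω (suppDomOfRecord F ν K s.Ω) (k + 1) (fun n => C₁ * B₃ * δ n) (lamDatum F K (k + 1) s.Ω) (avgFamily (avOfRecord F N K) 1) U :=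
  variationalThm1EULiftTop7MGB_body_at_flatDatum_lamDatum (fun ν K Ω => suppDomOfRecord F ν K Ω) ν M g K k s hk0 hkK hsep hM
    (suppDomOfRecord_truncSeq s hk0) hnum hc hc' hε hB₃ hC₁

/-- ★★ **THE LIFT TOKEN's BODY AT THE FLAT DATUM AND PRINT's DATUM IS INHABITED ON THE SUPPORT OF RECORD** (twin of ✓p760654 §4): for EVERY family `F`, numerics `ν` with `0 < ν.M₁`, cube
letter `M ≥ 1`, history `g`, torus `K`, length `k+1` (`0 < k`, `k+1 ≤ m+K`), thresholds in range, `0 ≤ B₃`, `2·L³ ≤ C₁`, the separated TOP index of record (K0's `exists_seq_top`) carries the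
body above. [cite: Balaban1985Variational, (11) p.279, (12)–(14) p.280; Balaban1988Convergent, (2.1) p.254, (2.18) p.257] -/
theorem variationalThm1EULiftCoP7MGB_binders_inhabited_flat_lamDatum
    (ν : Stage7Numerics) (hM₁ : 0 < ν.M₁) {M : ℕ} (hM : 1 ≤ M) (g : ℕ → ℝ) (K k : ℕ) (hk0 : 0 < k) (hkK : k + 1 ≤ (F.P K).m + (F.P K).K)
    {ε₀ C₁ B₃ a₀ a₁ : ℝ} {δ : ℕ → ℝ}
    (hnum : ∀ n, n ≤ k + 1 → 0 < δ n ∧ δ n ≤ a₁ ∧ B₃ * δ n ≤ ε₀) (hc : ∀ n, n < k + 1 → δ n ≤ 2 * δ (n + 1))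
    (hc' : ∀ n, n < k + 1 → δ (n + 1) ≤ 2 * δ n) (hε : ε₀ ≤ a₀) (hB₃ : 0 ≤ B₃) (hC₁ : 2 * ((F.P K).L : ℝ) ^ 3 ≤ C₁) :
    ∃ s : SeqOfRecord F ν M g K (k + 1), Sect2.SeqSeparated ν.M₁ s ∧
      ∃ (ε₀' : ℝ) (δ' : ℕ → ℝ) (V₀ : MSField (F.P K) (SU N)),
        (∀ n, n ≤ k → 0 < δ' n ∧ δ' n ≤ a₁ ∧ B₃ * δ' n ≤ ε₀') ∧ (∀ n, n < k → δ' n ≤ 2 * δ' (n + 1)) ∧ (∀ n, n < k → δ' (n + 1) ≤ 2 * δ' n) ∧ ε₀' ≤ a₀ ∧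
        dataSmall7PTopOf F N K (truncSeq s).Ω (suppDomOfRecord F ν K (truncSeq s).Ω) k δ' V₀ ∧
        ∀ U : GaugeField (F.P K) 0 (SU N),
          IsMinimizerB (avOfRecord F N K)
              {U | (∀ n, n ≤ k → PlaqSmallOn (Sect2.omegaPlaqsTop (truncSeq s).Ω (suppDomOfRecord F ν K (truncSeq s).Ω) n) (ε₀' * (F.P K).eta n ^ 2) U) ∧
                Sect2.CoDivClassOnTop (truncSeq s).Ω (suppDomOfRecord F ν K (truncSeq s).Ω) k ε₀' U} (lamDatum F K k (truncSeq s).Ω) V₀ U →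
          ((∀ n, n ≤ k → PlaqSmallOn (Sect2.omegaPlaqsTop (truncSeq s).Ω (suppDomOfRecord F ν K (truncSeq s).Ω) n) (B₃ * δ' n * (F.P K).eta n ^ 2) U) ∧
            ∀ n, n ≤ k → Sect2.CoDivSmallOn (Sect2.omegaBondsTop (truncSeq s).Ω (suppDomOfRecord F ν K (truncSeq s).Ω) n) (B₃ * δ' n * (F.P K).eta n ^ 3) U) →
          ApproxMinTopB (avOfRecord F N K) s.Ω (suppDomOfRecord F ν K s.Ω) (k + 1) (fun n => C₁ * B₃ * δ n) (lamDatum F K (k + 1) s.Ω) (avgFamily (avOfRecord F N K) 1) U := by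
  obtain ⟨s, -, hsep⟩ := exists_seq_top F ν hM g K (k + 1)
  exact ⟨s, hsep, variationalThm1EULiftCoP7MGB_body_at_flatDatum_lamDatum ν M g K k s hk0 hkK hsep hM₁ hnum hc hc' hε hB₃ hC₁⟩

end Lift


end Summit.QuantumFields.YangMills.BalabanUVNodes.N12EUStepTokensAtFlatDatumLam

end
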